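import Mathlib
import Summits.ValiantsHypothesis.ValiantsHypothesis.Theorems.LacunarySymmetroidMatrixDescartesCensusRealExponentsThreeByThreeLocus
import Summits.ValiantsHypothesis.ValiantsHypothesis.Theorems.LacunarySymmetroidMatrixDescartesCensusRealExponentsTwoByTwoBrackets
import Summits.ValiantsHypothesis.ValiantsHypothesis.Theorems.LacunarySymmetroidMatrixDescartesCensusDoorA

/-!
# `MatrixDescartes` census — `DoorA34` / `DoorA26`: failure is eventually visible in every shell, and by sign evaluations

HONEST FRAMING.  Object-search cell `pub-symmetroid`, items `DoorA34 = PosRootLawAt 3 4 18`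
(stmt-ValiantsHypothesis-19980) and `DoorA26 = PosRootLawAt 2 6 19` (stmt-ValiantsHypothesis-19979),
both OPEN, typed, never asserted.  Door-level spellings of the `3 × 3` / `2 × 2` structure theorems
(`…ThreeByThreeLocus`, `…TwoByTwoBrackets`); nothing is decided.  Nothing here bears on
`MatrixDescartes` (stmt-ValiantsHypothesis-18050) or `VP ≠ VNP`.

* `not_doorA34_iff_eventually_shell` (+ Theses spelling) — **if `DoorA34` fails, nineteens occur in
  EVERY sufficiently large shell** `{0 = d₀ ≤ d₁ ≤ d₂ ≤ d₃ = N}`: the `(3,4)` twin of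
  `not_doorA26_iff_eventually_shell` (via the NON-sharp `3 × 3` transfer; the sharp route
  `doorA34_iff_frequently_shell` gives the same statement — recorded here in the shell-failure form the
  census protocol reads);
* `exists_brackets_of_not_doorA34`, `exists_brackets_of_not_doorA26` — **a failure of either door is
  witnessed by SIGN EVALUATIONS**: some real symmetric pencil on some integer support changes the sign of
  its determinant across `19` (resp. `20`) pairwise disjoint positive brackets; by the IVT rows such a
  witness is also sufficient.  So a census event for either door never needs an even-multiplicity root.

[folklore] Pure logic on the companion files.
-/

-- `Summit.ValiantsHypothesis.ValiantsHypothesis.…` repeats a component by the D-0017 layout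
-- (single-conjunct summit), which the `dupNamespace` linter flags; the name is mandated.
set_option linter.dupNamespace false

namespace Summit.ValiantsHypothesis.ValiantsHypothesis.Theorems.LacunarySymmetroidMatrixDescartes.Census.RealExp

open Finset Polynomial
open scoped BigOperators Matrix
open Summit.ValiantsHypothesis.ValiantsHypothesis.Theorems.MatrixDescartes.Negative (PosRootLawAt)

section DoorCorollaries

/-- **If `DoorA34` fails, nineteens occur in EVERY sufficiently large shell** `{0 = d₀ ≤ ⋯ ≤ d₃ = N}`.
[folklore] -/
theorem not_doorA34_iff_eventually_shell :
    ¬ DoorA34 ↔ ∃ N₀ : ℕ, ∀ N : ℕ, N₀ ≤ N → ∃ d : Fin 4 → ℕ, Monotone d ∧ d 0 = 0 ∧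
      d (Fin.last 3) = N ∧ ¬ PosRootLawOn 3 4 18 d :=
  not_posRootLawAt_three_iff_eventually_shell 3 18

/-- `not_doorA34_iff_eventually_shell` in the route's spelling `Theses.LacunarySymmetroid.DoorA34`
(stmt-ValiantsHypothesis-19980). [folklore] -/
theorem theses_not_doorA34_iff_eventually_shell :
    ¬ Summit.ValiantsHypothesis.ValiantsHypothesis.Theses.LacunarySymmetroid.DoorA34 ↔
      ∃ N₀ : ℕ, ∀ N : ℕ, N₀ ≤ N → ∃ d : Fin 4 → ℕ, Monotone d ∧ d 0 = 0 ∧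
        d (Fin.last 3) = N ∧ ¬ PosRootLawOn 3 4 18 d :=
  not_posRootLawAt_three_iff_eventually_shell 3 18

/-- **A failure of `DoorA34` is witnessed by sign evaluations.**  If `DoorA34` fails, some real
symmetric `3 × 3` pencil on some `4`-term integer support changes the sign of its determinant across
`n ≥ 19` pairwise disjoint positive brackets. [folklore] -/
theorem exists_brackets_of_not_doorA34 (h : ¬ DoorA34) :
    ∃ (d : Fin 4 → ℕ) (S : Fin 4 → Matrix (Fin 3) (Fin 3) ℝ), (∀ l, (S l).IsSymm) ∧
      ∃ n : ℕ, 19 ≤ n ∧ ∃ a b : Fin n → ℝ, (∀ i, 0 < a i) ∧ (∀ i, a i < b i) ∧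
        (∀ i j, i < j → b i ≤ a j) ∧ ∀ i,
          ((∑ l, (X : ℝ[X]) ^ d l • (S l).map C).det.eval (a i)) *
            ((∑ l, (X : ℝ[X]) ^ d l • (S l).map C).det.eval (b i)) < 0 := by
  classical
  rw [doorA34_iff] at h
  push Not at h
  obtain ⟨d, S, hS, hlt⟩ := h
  obtain ⟨S', hS', hrest⟩ := exists_brackets_of_le_card_posRoots_three d S hS (by norm_num) hlt
  exact ⟨d, S', hS', hrest⟩

/-- **A failure of `DoorA26` is witnessed by sign evaluations.**  If `DoorA26` fails, some real
symmetric `2 × 2` pencil on some `6`-term integer support changes the sign of its determinant across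
`n ≥ 20` pairwise disjoint positive brackets. [folklore] -/
theorem exists_brackets_of_not_doorA26 (h : ¬ DoorA26) :
    ∃ (d : Fin 6 → ℕ) (S : Fin 6 → Matrix (Fin 2) (Fin 2) ℝ), (∀ l, (S l).IsSymm) ∧
      ∃ n : ℕ, 20 ≤ n ∧ ∃ a b : Fin n → ℝ, (∀ i, 0 < a i) ∧ (∀ i, a i < b i) ∧
        (∀ i j, i < j → b i ≤ a j) ∧ ∀ i,
          ((∑ l, (X : ℝ[X]) ^ d l • (S l).map C).det.eval (a i)) *
            ((∑ l, (X : ℝ[X]) ^ d l • (S l).map C).det.eval (b i)) < 0 := by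
  classical
  rw [doorA26_iff] at h
  push Not at h
  obtain ⟨d, S, hS, hlt⟩ := h
  obtain ⟨S', hS', hrest⟩ := exists_brackets_of_le_card_posRoots_two d S hS (by norm_num) hlt
  exact ⟨d, S', hS', hrest⟩

/-- Conversely, `20` disjoint positive sign-change brackets of ONE symmetric `2 × 2` six-term pencil
refute `DoorA26` (IVT; the census-event form). [folklore] -/
theorem not_doorA26_of_brackets (d : Fin 6 → ℕ) (S : Fin 6 → Matrix (Fin 2) (Fin 2) ℝ)
    (hS : ∀ l, (S l).IsSymm) {n : ℕ} (hn : 20 ≤ n) (a b : Fin n → ℝ) (hpos : ∀ i, 0 < a i)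
    (hab : ∀ i, a i < b i) (hdisj : ∀ i j, i < j → b i ≤ a j)
    (hsign : ∀ i, ((∑ l, (X : ℝ[X]) ^ d l • (S l).map C).det.eval (a i)) *
      ((∑ l, (X : ℝ[X]) ^ d l • (S l).map C).det.eval (b i)) < 0) : ¬ DoorA26 := by
  intro hdoor
  have h20 := ((exists_le_card_posRoots_iff_exists_brackets_two d (by norm_num : 0 < 20)).mpr
    ⟨S, hS, n, hn, a, b, hpos, hab, hdisj, hsign⟩)
  obtain ⟨S', hS', hcard⟩ := h20
  exact absurd (hcard.trans (hdoor d S' hS')) (by norm_num)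

end DoorCorollaries

end Summit.ValiantsHypothesis.ValiantsHypothesis.Theorems.LacunarySymmetroidMatrixDescartes.Census.RealExp
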